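import Summits.BirchSwinnertonDyer.BirchSwinnertonDyer.Theorems.EisensteinPrimesH2BookkeepingZpExtension
import Summits.BirchSwinnertonDyer.BirchSwinnertonDyer.Theorems.EisensteinPrimesTwistDeformationFullAtSelmerOfFacts
import HarnessLib

/-!
# The `H²` bookkeeping for an arbitrary spelling of `Σ = S₀ ∪ {w ∣ p}`, and at the crux's places `{v, v̄} ∪ Sf`
# (cell `bsd-eis`, seat `bsd-line-x1-p1-w4` gen 4; crux 2 `GoodLatticeBDPValue` stmt-BirchSwinnertonDyer-19032, line `halves`,
# V21 road S4 — file (F))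

HONEST FRAMING (cell `bsd-eis`, run/shared/lean/pub/bsd-eis/): bookkeeping (no definition, no named fact introduced — `cd_p(G_{K,Σ}) ≤ 2`
= `GaloisCohomology.groupCdLE_two_galoisGroupUnramifiedOutside K` [PUB] stays a HYPOTHESIS —, no `sorry`, no `Theses` import);
nothing about any curve is asserted; BSD / IMC2 / KY Thm. 1.4.1 are proved for NO curve. Helper `--supports stmt-BirchSwinnertonDyer-19032`.

## What

Files (C) `…H2BookkeepingUnramifiedOutside` (p647958) and (E) `…H2BookkeepingZpExtension` (p648541) state the weak-Leopoldt inputs over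
`G_{K,Σ} = GaloisGroupUnramifiedOutside K (S₀ ∪ {v | ↑p ∈ v.asIdeal})`. The twist-deformation lane (w2/w3, `…AcTwistDeformation*`,
`…WeakLeopoldtAbove*`) writes the same set of places as `↑(insert v (insert vbar Sf))`. Since the TYPE `G_{K,S}` depends on the
spelling of `S`, this file re-issues the `hH2` theorems for ANY `S` with a proof `hS : S = S₀ ∪ {v | ↑p ∈ v.asIdeal}`
(`natCard_H2bookkeeping_unramifiedOutside_of_eq`, `…_kerSubgroup_of_eq`), proves the set identity
`↑(insert v (insert vbar Sf)) = ↑Sf ∪ {w | ↑p ∈ w.asIdeal}` for `p = v v̄` split in a quadratic `K` (`coe_insert_insert_eq_union`), and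
concludes the crux-shaped corollary `natCard_H2bookkeeping_unramifiedOutside_insert_insert` (K imaginary quadratic, `κ` any
`ℤ_p`-extension, `H = ker κ`, `S₀ = Sf`).

References: [KellerYin2024] §1.4; [NeukirchANT1999] I §8; [Harari2020] Cor. 17.14.
-/

set_option autoImplicit false
set_option linter.dupNamespace false -- the summit namespace `…BirchSwinnertonDyer.BirchSwinnertonDyer.Theorems` (Sub = Summit, D-0017) trips it

noncomputable section

open scoped Classical

namespace Summit.BirchSwinnertonDyer.BirchSwinnertonDyer.Theorems.UnramifiedInflation

open CategoryTheory Function NumberField IsDedekindDomain Field Topology ContinuousCohomology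
open Literature.NumberTheory.EllipticCurves Literature.NumberTheory.EllipticCurves.GreenbergSelmer
  Literature.NumberTheory.EllipticCurves.GreenbergVatsal2000 Literature.NumberTheory.GaloisRepresentations
  Literature.NumberTheory.IwasawaTheory.Greenberg2006

variable {K : Type} [Field K] [NumberField K]

/-! ## §1 `{v, v̄} ∪ Sf = Sf ∪ {w ∣ p}` -/

/-- In a quadratic field with `p = v v̄` split (`v ≠ v̄` both above `p`), `{v, v̄} ∪ Sf = Sf ∪ {w ∣ p}` as sets of places.
[cite: NeukirchANT1999, Ch. I §8 Prop. (8.2)] -/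
theorem coe_insert_insert_eq_union {p : ℕ} [Fact p.Prime] (h2 : Module.finrank ℚ K = 2) {v vbar : HeightOneSpectrum (𝓞 K)}
    (hv : ((p : ℕ) : 𝓞 K) ∈ v.asIdeal) (hvbar : ((p : ℕ) : 𝓞 K) ∈ vbar.asIdeal) (hne : vbar ≠ v)
    (Sf : Finset (HeightOneSpectrum (𝓞 K))) :
    (↑(insert v (insert vbar Sf)) : Set (HeightOneSpectrum (𝓞 K))) = ↑Sf ∪ {w | ((p : ℕ) : 𝓞 K) ∈ w.asIdeal} := by
  ext w
  rw [Finset.coe_insert, Finset.coe_insert]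
  constructor
  · rintro (rfl | rfl | hw)
    · exact Or.inr hv
    · exact Or.inr hvbar
    · exact Or.inl hw
  · rintro (hw | hw)
    · exact Or.inr (Or.inr hw)
    · rcases GreenbergFullAtSelmer.eq_or_eq_of_natCast_mem_of_ne h2 hv hvbar hne hw with rfl | rfl
      · exact Or.inl rfl
      · exact Or.inr (Or.inl rfl)

/-! ## §2 Any spelling of `Σ` -/

section AnyS

variable (H : Subgroup (absoluteGaloisGroup K)) [H.Normal] (p : ℕ) [Fact p.Prime] (S₀ S : Set (HeightOneSpectrum (𝓞 K)))
variable {N₁ : Type} [AddCommGroup N₁] [DistribMulAction (absoluteGaloisGroup K) N₁] [TopologicalSpace N₁] [DiscreteTopology N₁]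
variable {N₂ : Type} [AddCommGroup N₂] [DistribMulAction (absoluteGaloisGroup K) N₂] [TopologicalSpace N₂] [DiscreteTopology N₂]
variable {N₃ : Type} [AddCommGroup N₃] [DistribMulAction (absoluteGaloisGroup K) N₃] [TopologicalSpace N₃] [DiscreteTopology N₃]
variable {A₁ : Type} [AddCommGroup A₁] [DistribMulAction (absoluteGaloisGroup K) A₁] [TopologicalSpace A₁] [DiscreteTopology A₁]
variable {A₂ : Type} [AddCommGroup A₂] [DistribMulAction (absoluteGaloisGroup K) A₂] [TopologicalSpace A₂] [DiscreteTopology A₂]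
variable {A₃ : Type} [AddCommGroup A₃] [DistribMulAction (absoluteGaloisGroup K) A₃] [TopologicalSpace A₃] [DiscreteTopology A₃]

/-- **`hH2` for any spelling `S` of `S₀ ∪ {w ∣ p}`** (general closed `H ⊴ Γ_K` with `N_S ≤ H`; the three `A_k` descended to `G_{K,S}`
with weak Leopoldt in the `ContinuousRep.H 2` spelling; `cd_p(G_{K,S}) ≤ 2` [PUB] a hypothesis).
[cite: KellerYin2024, §1.4 (proof of Thm. 1.4.1 (iii))] [cite: Harari2020, Cor. 17.14 (p. 295)] -/
theorem natCard_H2bookkeeping_unramifiedOutside_of_eq (hS : S = S₀ ∪ {v | ((p : ℕ) : 𝓞 K) ∈ v.asIdeal})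
    (hH : IsClosed (H : Set (absoluteGaloisGroup K))) (hNH : ramificationSubgroup K S ≤ H)
    (i : N₁ →+ N₂) (π : N₂ →+ N₃)
    (hi : ∀ (g : absoluteGaloisGroup K) (a : N₁), i (g • a) = g • i a)
    (hπ : ∀ (g : absoluteGaloisGroup K) (b : N₂), π (g • b) = g • π b)
    (hiinj : Injective i) (hπsurj : Surjective π) (hexact : ∀ b : N₂, π b = 0 → ∃ a : N₁, i a = b)
    (hπi : ∀ a : N₁, π (i a) = 0)
    (j₁ : N₁ →+ A₁) (j₂ : N₂ →+ A₂) (j₃ : N₃ →+ A₃)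
    (hj₁ : ∀ (g : absoluteGaloisGroup K) (a : N₁), j₁ (g • a) = g • j₁ a)
    (hj₂ : ∀ (g : absoluteGaloisGroup K) (a : N₂), j₂ (g • a) = g • j₂ a)
    (hj₃ : ∀ (g : absoluteGaloisGroup K) (a : N₃), j₃ (g • a) = g • j₃ a)
    (hj₁inj : Injective j₁) (hj₂inj : Injective j₂) (hj₃inj : Injective j₃)
    (hr₁ : ∀ x : A₁, x ∈ j₁.range ↔ p • x = 0) (hr₂ : ∀ x : A₂, x ∈ j₂.range ↔ p • x = 0)
    (hr₃ : ∀ x : A₃, x ∈ j₃.range ↔ p • x = 0)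
    (hd₁ : ∀ x : A₁, ∃ x' : A₁, p • x' = x) (hd₂ : ∀ x : A₂, ∃ x' : A₂, p • x' = x)
    (hd₃ : ∀ x : A₃, ∃ x' : A₃, p • x' = x)
    (hcN₁ : ∀ a : N₁, Continuous fun g : absoluteGaloisGroup K ↦ g • a)
    (hcN₂ : ∀ a : N₂, Continuous fun g : absoluteGaloisGroup K ↦ g • a)
    (hcN₃ : ∀ a : N₃, Continuous fun g : absoluteGaloisGroup K ↦ g • a)
    (ρA₁ : ContinuousRep (GaloisGroupUnramifiedOutside K S) ℤ A₁)
    (ρA₂ : ContinuousRep (GaloisGroupUnramifiedOutside K S) ℤ A₂)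
    (ρA₃ : ContinuousRep (GaloisGroupUnramifiedOutside K S) ℤ A₃)
    (hρA₁ : ∀ (σ : absoluteGaloisGroup K) (m : A₁), ρA₁ (toUnramifiedQuot K S σ) m = σ • m)
    (hρA₂ : ∀ (σ : absoluteGaloisGroup K) (m : A₂), ρA₂ (toUnramifiedQuot K S σ) m = σ • m)
    (hρA₃ : ∀ (σ : absoluteGaloisGroup K) (m : A₃), ρA₃ (toUnramifiedQuot K S σ) m = σ • m)
    (hWL₁ : Subsingleton ((ρA₁.restrict (galoisGroupAboveSubtype S H)).H 2))
    (hWL₂ : Subsingleton ((ρA₂.restrict (galoisGroupAboveSubtype S H)).H 2))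
    (hWL₃ : Subsingleton ((ρA₃.restrict (galoisGroupAboveSubtype S H)).H 2))
    (hcd : Literature.NumberTheory.GaloisCohomology.groupCdLE_two_galoisGroupUnramifiedOutside K)
    (hreal : (∃ w : InfinitePlace K, w.IsReal) → p ≠ 2) :
    Nat.card (↥(unramifiedOutside H N₃ p S₀) ⧸
        ((unramifiedOutside H N₂ p S₀).map (resH1Hom (ContinuousMonoidHom.id H) π
          (fun g b ↦ hπ (g : absoluteGaloisGroup K) b))).addSubgroupOf (unramifiedOutside H N₃ p S₀)) *
        Nat.card (ModN (unramifiedOutside H A₂ p S₀) p) =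
      Nat.card (ModN (unramifiedOutside H A₁ p S₀) p) * Nat.card (ModN (unramifiedOutside H A₃ p S₀) p) := by
  subst hS
  haveI : Subsingleton (continuousCohomology 2
      (ρA₁.restrict (galoisGroupAboveSubtype (S₀ ∪ {v | ((p : ℕ) : 𝓞 K) ∈ v.asIdeal}) H)).toTopRep) := hWL₁
  haveI : Subsingleton (continuousCohomology 2
      (ρA₂.restrict (galoisGroupAboveSubtype (S₀ ∪ {v | ((p : ℕ) : 𝓞 K) ∈ v.asIdeal}) H)).toTopRep) := hWL₂
  haveI : Subsingleton (continuousCohomology 2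
      (ρA₃.restrict (galoisGroupAboveSubtype (S₀ ∪ {v | ((p : ℕ) : 𝓞 K) ∈ v.asIdeal}) H)).toTopRep) := hWL₃
  exact natCard_H2bookkeeping_unramifiedOutside_of_continuous H p S₀ hH hNH i π hi hπ hiinj hπsurj hexact hπi j₁ j₂ j₃
    hj₁ hj₂ hj₃ hj₁inj hj₂inj hj₃inj hr₁ hr₂ hr₃ hd₁ hd₂ hd₃ hcN₁ hcN₂ hcN₃ ρA₁ ρA₂ ρA₃ hρA₁ hρA₂ hρA₃ hcd hreal

/-- **`hH2` over `K_∞ = K̄^{ker κ}` for any spelling `S` of `S₀ ∪ {w ∣ p}`** (`K` totally complex, `κ` any `ℤ_p`-extension).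
[cite: KellerYin2024, §1.4 (proof of Thm. 1.4.1 (iii))] [cite: Harari2020, Cor. 17.14 (p. 295)] [cite: Washington1997, Prop. 13.2] -/
theorem natCard_H2bookkeeping_unramifiedOutside_kerSubgroup_of_eq [IsTotallyComplex K] (κ : ZpExtension K p)
    (hS : S = S₀ ∪ {v | ((p : ℕ) : 𝓞 K) ∈ v.asIdeal})
    (i : N₁ →+ N₂) (π : N₂ →+ N₃)
    (hi : ∀ (g : absoluteGaloisGroup K) (a : N₁), i (g • a) = g • i a)
    (hπ : ∀ (g : absoluteGaloisGroup K) (b : N₂), π (g • b) = g • π b)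
    (hiinj : Injective i) (hπsurj : Surjective π) (hexact : ∀ b : N₂, π b = 0 → ∃ a : N₁, i a = b)
    (hπi : ∀ a : N₁, π (i a) = 0)
    (j₁ : N₁ →+ A₁) (j₂ : N₂ →+ A₂) (j₃ : N₃ →+ A₃)
    (hj₁ : ∀ (g : absoluteGaloisGroup K) (a : N₁), j₁ (g • a) = g • j₁ a)
    (hj₂ : ∀ (g : absoluteGaloisGroup K) (a : N₂), j₂ (g • a) = g • j₂ a)
    (hj₃ : ∀ (g : absoluteGaloisGroup K) (a : N₃), j₃ (g • a) = g • j₃ a)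
    (hj₁inj : Injective j₁) (hj₂inj : Injective j₂) (hj₃inj : Injective j₃)
    (hr₁ : ∀ x : A₁, x ∈ j₁.range ↔ p • x = 0) (hr₂ : ∀ x : A₂, x ∈ j₂.range ↔ p • x = 0)
    (hr₃ : ∀ x : A₃, x ∈ j₃.range ↔ p • x = 0)
    (hd₁ : ∀ x : A₁, ∃ x' : A₁, p • x' = x) (hd₂ : ∀ x : A₂, ∃ x' : A₂, p • x' = x)
    (hd₃ : ∀ x : A₃, ∃ x' : A₃, p • x' = x)
    (hcN₁ : ∀ a : N₁, Continuous fun g : absoluteGaloisGroup K ↦ g • a)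
    (hcN₂ : ∀ a : N₂, Continuous fun g : absoluteGaloisGroup K ↦ g • a)
    (hcN₃ : ∀ a : N₃, Continuous fun g : absoluteGaloisGroup K ↦ g • a)
    (ρA₁ : ContinuousRep (GaloisGroupUnramifiedOutside K S) ℤ A₁)
    (ρA₂ : ContinuousRep (GaloisGroupUnramifiedOutside K S) ℤ A₂)
    (ρA₃ : ContinuousRep (GaloisGroupUnramifiedOutside K S) ℤ A₃)
    (hρA₁ : ∀ (σ : absoluteGaloisGroup K) (m : A₁), ρA₁ (toUnramifiedQuot K S σ) m = σ • m)
    (hρA₂ : ∀ (σ : absoluteGaloisGroup K) (m : A₂), ρA₂ (toUnramifiedQuot K S σ) m = σ • m)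
    (hρA₃ : ∀ (σ : absoluteGaloisGroup K) (m : A₃), ρA₃ (toUnramifiedQuot K S σ) m = σ • m)
    (hWL₁ : Subsingleton ((ρA₁.restrict (galoisGroupAboveSubtype S κ.kerSubgroup)).H 2))
    (hWL₂ : Subsingleton ((ρA₂.restrict (galoisGroupAboveSubtype S κ.kerSubgroup)).H 2))
    (hWL₃ : Subsingleton ((ρA₃.restrict (galoisGroupAboveSubtype S κ.kerSubgroup)).H 2))
    (hcd : Literature.NumberTheory.GaloisCohomology.groupCdLE_two_galoisGroupUnramifiedOutside K) :
    Nat.card (↥(unramifiedOutside κ.kerSubgroup N₃ p S₀) ⧸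
        ((unramifiedOutside κ.kerSubgroup N₂ p S₀).map (resH1Hom (ContinuousMonoidHom.id κ.kerSubgroup) π
          (fun g b ↦ hπ (g : absoluteGaloisGroup K) b))).addSubgroupOf (unramifiedOutside κ.kerSubgroup N₃ p S₀)) *
        Nat.card (ModN (unramifiedOutside κ.kerSubgroup A₂ p S₀) p) =
      Nat.card (ModN (unramifiedOutside κ.kerSubgroup A₁ p S₀) p) * Nat.card (ModN (unramifiedOutside κ.kerSubgroup A₃ p S₀) p) := by
  subst hS
  exact natCard_H2bookkeeping_unramifiedOutside_kerSubgroup κ S₀ i π hi hπ hiinj hπsurj hexact hπi j₁ j₂ j₃ hj₁ hj₂ hj₃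
    hj₁inj hj₂inj hj₃inj hr₁ hr₂ hr₃ hd₁ hd₂ hd₃ hcN₁ hcN₂ hcN₃ ρA₁ ρA₂ ρA₃ hρA₁ hρA₂ hρA₃ hWL₁ hWL₂ hWL₃ hcd

end AnyS

/-! ## §3 The crux's spelling: `K` imaginary quadratic, `p = v v̄`, `S = {v, v̄} ∪ Sf`, `S₀ = Sf`, `H = ker κ` -/

section Crux

variable {p : ℕ} [Fact p.Prime]
variable {N₁ : Type} [AddCommGroup N₁] [DistribMulAction (absoluteGaloisGroup K) N₁] [TopologicalSpace N₁] [DiscreteTopology N₁]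
variable {N₂ : Type} [AddCommGroup N₂] [DistribMulAction (absoluteGaloisGroup K) N₂] [TopologicalSpace N₂] [DiscreteTopology N₂]
variable {N₃ : Type} [AddCommGroup N₃] [DistribMulAction (absoluteGaloisGroup K) N₃] [TopologicalSpace N₃] [DiscreteTopology N₃]
variable {A₁ : Type} [AddCommGroup A₁] [DistribMulAction (absoluteGaloisGroup K) A₁] [TopologicalSpace A₁] [DiscreteTopology A₁]
variable {A₂ : Type} [AddCommGroup A₂] [DistribMulAction (absoluteGaloisGroup K) A₂] [TopologicalSpace A₂] [DiscreteTopology A₂]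
variable {A₃ : Type} [AddCommGroup A₃] [DistribMulAction (absoluteGaloisGroup K) A₃] [TopologicalSpace A₃] [DiscreteTopology A₃]

/-- **`hH2` at the crux's binders**: `K` imaginary quadratic, `p = v v̄` split (`v̄ ≠ v` both above `p`), `Sf` a finite set of places,
`S = {v, v̄} ∪ Sf`, `κ` a `ℤ_p`-extension of `K` (`K_∞ = K̄^{ker κ}`); residual/Kummer data; the three `A_k` descended to `G_{K,S}`
with weak Leopoldt `H²(K_S/K_∞, A_k) = 0`; `cd_p(G_{K,S}) ≤ 2` [PUB]: the `hH2` hypothesis of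
`ResidualIndexAssembly.zpCorank_datumStrictSelmer_add_eq` at `H = κ.kerSubgroup`, `S₀ = Sf`, verbatim.
[cite: KellerYin2024, §1.4 (proof of Thm. 1.4.1 (iii))] [cite: Harari2020, Cor. 17.14 (p. 295)] -/
theorem natCard_H2bookkeeping_unramifiedOutside_insert_insert (hK : IsImaginaryQuadratic K)
    {v vbar : HeightOneSpectrum (𝓞 K)} (hv : ((p : ℕ) : 𝓞 K) ∈ v.asIdeal) (hvbar : ((p : ℕ) : 𝓞 K) ∈ vbar.asIdeal)
    (hne : vbar ≠ v) (Sf : Finset (HeightOneSpectrum (𝓞 K))) (κ : ZpExtension K p)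
    (i : N₁ →+ N₂) (π : N₂ →+ N₃)
    (hi : ∀ (g : absoluteGaloisGroup K) (a : N₁), i (g • a) = g • i a)
    (hπ : ∀ (g : absoluteGaloisGroup K) (b : N₂), π (g • b) = g • π b)
    (hiinj : Injective i) (hπsurj : Surjective π) (hexact : ∀ b : N₂, π b = 0 → ∃ a : N₁, i a = b)
    (hπi : ∀ a : N₁, π (i a) = 0)
    (j₁ : N₁ →+ A₁) (j₂ : N₂ →+ A₂) (j₃ : N₃ →+ A₃)
    (hj₁ : ∀ (g : absoluteGaloisGroup K) (a : N₁), j₁ (g • a) = g • j₁ a)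
    (hj₂ : ∀ (g : absoluteGaloisGroup K) (a : N₂), j₂ (g • a) = g • j₂ a)
    (hj₃ : ∀ (g : absoluteGaloisGroup K) (a : N₃), j₃ (g • a) = g • j₃ a)
    (hj₁inj : Injective j₁) (hj₂inj : Injective j₂) (hj₃inj : Injective j₃)
    (hr₁ : ∀ x : A₁, x ∈ j₁.range ↔ p • x = 0) (hr₂ : ∀ x : A₂, x ∈ j₂.range ↔ p • x = 0)
    (hr₃ : ∀ x : A₃, x ∈ j₃.range ↔ p • x = 0)
    (hd₁ : ∀ x : A₁, ∃ x' : A₁, p • x' = x) (hd₂ : ∀ x : A₂, ∃ x' : A₂, p • x' = x)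
    (hd₃ : ∀ x : A₃, ∃ x' : A₃, p • x' = x)
    (hcN₁ : ∀ a : N₁, Continuous fun g : absoluteGaloisGroup K ↦ g • a)
    (hcN₂ : ∀ a : N₂, Continuous fun g : absoluteGaloisGroup K ↦ g • a)
    (hcN₃ : ∀ a : N₃, Continuous fun g : absoluteGaloisGroup K ↦ g • a)
    (ρA₁ : ContinuousRep (GaloisGroupUnramifiedOutside K (↑(insert v (insert vbar Sf)))) ℤ A₁)
    (ρA₂ : ContinuousRep (GaloisGroupUnramifiedOutside K (↑(insert v (insert vbar Sf)))) ℤ A₂)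
    (ρA₃ : ContinuousRep (GaloisGroupUnramifiedOutside K (↑(insert v (insert vbar Sf)))) ℤ A₃)
    (hρA₁ : ∀ (σ : absoluteGaloisGroup K) (m : A₁), ρA₁ (toUnramifiedQuot K _ σ) m = σ • m)
    (hρA₂ : ∀ (σ : absoluteGaloisGroup K) (m : A₂), ρA₂ (toUnramifiedQuot K _ σ) m = σ • m)
    (hρA₃ : ∀ (σ : absoluteGaloisGroup K) (m : A₃), ρA₃ (toUnramifiedQuot K _ σ) m = σ • m)
    (hWL₁ : Subsingleton ((ρA₁.restrict (galoisGroupAboveSubtype _ κ.kerSubgroup)).H 2))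
    (hWL₂ : Subsingleton ((ρA₂.restrict (galoisGroupAboveSubtype _ κ.kerSubgroup)).H 2))
    (hWL₃ : Subsingleton ((ρA₃.restrict (galoisGroupAboveSubtype _ κ.kerSubgroup)).H 2))
    (hcd : Literature.NumberTheory.GaloisCohomology.groupCdLE_two_galoisGroupUnramifiedOutside K) :
    Nat.card (↥(unramifiedOutside κ.kerSubgroup N₃ p ↑Sf) ⧸
        ((unramifiedOutside κ.kerSubgroup N₂ p ↑Sf).map (resH1Hom (ContinuousMonoidHom.id κ.kerSubgroup) π
          (fun g b ↦ hπ (g : absoluteGaloisGroup K) b))).addSubgroupOf (unramifiedOutside κ.kerSubgroup N₃ p ↑Sf)) *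
        Nat.card (ModN (unramifiedOutside κ.kerSubgroup A₂ p ↑Sf) p) =
      Nat.card (ModN (unramifiedOutside κ.kerSubgroup A₁ p ↑Sf) p) * Nat.card (ModN (unramifiedOutside κ.kerSubgroup A₃ p ↑Sf) p) := by
  haveI : IsTotallyComplex K := hK.2
  have hS : (↑(insert v (insert vbar Sf)) : Set (HeightOneSpectrum (𝓞 K))) = ↑Sf ∪ {w | ((p : ℕ) : 𝓞 K) ∈ w.asIdeal} :=
    coe_insert_insert_eq_union hK.1 hv hvbar hne Sf
  have h := natCard_H2bookkeeping_unramifiedOutside_kerSubgroup_of_eq p (↑Sf : Set (HeightOneSpectrum (𝓞 K)))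
    (↑(insert v (insert vbar Sf)) : Set (HeightOneSpectrum (𝓞 K))) κ hS
    i π hi hπ hiinj hπsurj hexact hπi j₁ j₂ j₃ hj₁ hj₂ hj₃ hj₁inj hj₂inj hj₃inj hr₁ hr₂ hr₃ hd₁ hd₂ hd₃ hcN₁ hcN₂ hcN₃
    ρA₁ ρA₂ ρA₃ hρA₁ hρA₂ hρA₃ hWL₁ hWL₂ hWL₃ hcd
  exact h

end Crux

end Summit.BirchSwinnertonDyer.BirchSwinnertonDyer.Theorems.UnramifiedInflation

end
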